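import Summits.ResolutionOfSingularities.ResolutionOfSingularities.Theorems.HilbertSamuelEliminationCampaignW42DirectrixDrop
import Summits.ResolutionOfSingularities.ResolutionOfSingularities.Theorems.HilbertSamuelEliminationSigmaMaxModificationsCorridor3WLadderNearPointDirDim
import Summits.ResolutionOfSingularities.ResolutionOfSingularities.Theorems.HilbertSamuelEliminationSigmaMaxModificationsCorridor3WLadderLocalChainsDefs
import Literature.AlgebraicGeometry.Resolution.PermissibleBlowupDirectrixNear
import Literature.AlgebraicGeometry.Resolution.PermissibleBlowupDirectrixRational
import HarnessLib

/-!
# [OURS · L1 W4.2] The consumers of CJS Thm. 3.10 (4) WITHOUT THE BINDER: `e_{x'}(X')_K ≤ e_x(X)_K`, `ē_{x'} ≤ ē_x`,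
# `e_{x'} ≤ e_x` at rational near points — unconditionally (campaign s42, cell res-hironaka; informal crux `RidgeConfinement`,
# stmt-ResolutionOfSingularities-17845, serving the corridor crux stmt-ResolutionOfSingularities-19249; `--supports`)

HONEST FRAMING. OURS (slot W4.2, prover res-L1-s42-pv-1, gen 6). [OURS · L1 W4.2] replaces the role of nothing printed in
H. Hironaka's manuscript. The named fact `CossartJannsenSaito2020_thm_3_10_4` is a theorem of the tree
(`Literature.AlgebraicGeometry.Resolution.CossartJannsenSaito2020_thm_3_10_4_holds`, `…CampaignW42DirectrixDrop`, gen 6); this file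
merely instantiates the binder `(h : CossartJannsenSaito2020_thm_3_10_4)` of the tree's consumer lemmas
(`PermissibleBlowupDirectrixNear.lean`, `PermissibleBlowupDirectrixRational.lean`, `…WLadderNearPointDirDim`) so that the W4.2
files can drop it mechanically: `dirDimOver_le_of_hsFun_eq_unconditional`, `geomDirDim_le_of_hsFun_eq_unconditional`,
`geomDirDim_le_of_hsFun_eq_of_isClosed_unconditional`, `dirDim_le_dirDimOver_of_hsFun_eq_unconditional`,
`dirDim_le_of_hsFun_eq_of_isIso_residueFieldMap_unconditional`, `dirDim_le_dirDim_of_hsFun_eq_of_bijective_unconditional`;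
and the W-ladder bundle `Moving.LocalChainPrintedFacts` (six printed facts) is assembled from the other FIVE
(`localChainPrintedFacts_of_five`).

NOT a statement of H. Hironaka's manuscript [Hironaka2017]. AI review is weaker than expert review. References (orientation
only): V. Cossart, U. Jannsen, S. Saito, LNM 2270 (2020), Thm. 3.10 (4), Def. 2.18, Def. 2.21.
-/

noncomputable section

-- single-conjunct summit: the doubled namespace component `ResolutionOfSingularities` is mandated
set_option linter.dupNamespace false

open CategoryTheory AlgebraicGeometry TopologicalSpace IsLocalRing
open Literature.AlgebraicGeometry.Resolution Literature.RingTheory.HilbertSamuel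
open Literature.AlgebraicGeometry.CossartJannsenSaito2020

namespace Summit.ResolutionOfSingularities.ResolutionOfSingularities.Theorems

namespace CampaignW42

universe u

variable {X X' : Scheme.{u}} [IsLocallyNoetherian X] [IsLocallyNoetherian X'] {π : X' ⟶ X} {D : X.IdealSheafData}

/-- **`e_{x'}(X')_K ≤ e_x(X)_K` at a near point, every `K`, unconditionally.** [cite: CossartJannsenSaito2020, Thm. 3.10 (4)] -/
theorem dirDimOver_le_of_hsFun_eq_unconditional (hX : Scheme.IsExcellent X) (hD : IdealSheafData.IsPermissible D)
    (hπ : IsBlowup π D) {N : ℕ} (hN : topologicalKrullDim X ≤ (N : WithBot ℕ∞)) {x' : X'}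
    (hx : π.base x' ∈ (D.support : Set X)) (hnear : Scheme.hsFun X' N x' = Scheme.hsFun X N (π.base x'))
    (K : Type u) [Field K] [Algebra (ResidueField (X'.presheaf.stalk x')) K]
    [Algebra (ResidueField (X.presheaf.stalk (π.base x'))) K]
    (halg : ∀ a, algebraMap (ResidueField (X.presheaf.stalk (π.base x'))) K a =
      algebraMap (ResidueField (X'.presheaf.stalk x')) K ((π.residueFieldMap x').hom a)) :
    Scheme.dirDimOver X' x' K ≤ Scheme.dirDimOver X (π.base x') K :=
  dirDimOver_le_of_hsFun_eq CossartJannsenSaito2020_thm_3_10_4_holds hX hD hπ hN hx hnear K halg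

/-- **`ē_{x'}(X') ≤ ē_x(X)` at a near point with algebraic residue extension, unconditionally** (the tree also has the
binder-free `CampaignW42.geomDirDim_le_of_isNearPoint`, gen 5, by the ridge). [cite: CossartJannsenSaito2020, Thm. 3.10 (4), Def. 2.21] -/
theorem geomDirDim_le_of_hsFun_eq_unconditional (hX : Scheme.IsExcellent X) (hD : IdealSheafData.IsPermissible D)
    (hπ : IsBlowup π D) {N : ℕ} (hN : topologicalKrullDim X ≤ (N : WithBot ℕ∞)) {x' : X'}
    (hx : π.base x' ∈ (D.support : Set X)) (hnear : Scheme.hsFun X' N x' = Scheme.hsFun X N (π.base x'))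
    (hint : (π.residueFieldMap x').hom.IsIntegral) :
    Scheme.geomDirDim X' x' ≤ Scheme.geomDirDim X (π.base x') :=
  geomDirDim_le_of_hsFun_eq CossartJannsenSaito2020_thm_3_10_4_holds hX hD hπ hN hx hnear hint

/-- **`ē_{x'}(X') ≤ ē_{π x'}(X)` at a CLOSED near point, unconditionally.** [cite: CossartJannsenSaito2020, Thm. 3.10 (4), Def. 2.21] -/
theorem geomDirDim_le_of_hsFun_eq_of_isClosed_unconditional (hX : Scheme.IsExcellent X) (hD : IdealSheafData.IsPermissible D)
    (hπ : IsBlowup π D) {N : ℕ} (hN : topologicalKrullDim X ≤ (N : WithBot ℕ∞)) {x' : X'}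
    (hx : π.base x' ∈ (D.support : Set X)) (hcl : IsClosed ({x'} : Set X'))
    (hnear : Scheme.hsFun X' N x' = Scheme.hsFun X N (π.base x')) :
    Scheme.geomDirDim X' x' ≤ Scheme.geomDirDim X (π.base x') :=
  geomDirDim_le_of_hsFun_eq_of_isClosed CossartJannsenSaito2020_thm_3_10_4_holds hX hD hπ hN hx hcl hnear

/-- **`e_{x'}(X') ≤ e_x(X)_{κ(x')}` at a near point, unconditionally.** [cite: CossartJannsenSaito2020, Thm. 3.10 (4), Def. 2.18] -/
theorem dirDim_le_dirDimOver_of_hsFun_eq_unconditional (hX : Scheme.IsExcellent X) (hD : IdealSheafData.IsPermissible D)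
    (hπ : IsBlowup π D) {N : ℕ} (hN : topologicalKrullDim X ≤ (N : WithBot ℕ∞)) {x' : X'}
    (hx : π.base x' ∈ (D.support : Set X)) (hnear : Scheme.hsFun X' N x' = Scheme.hsFun X N (π.base x')) :
    Scheme.dirDim X' x' ≤
      @Scheme.dirDimOver X _ (π.base x') (ResidueField (X'.presheaf.stalk x')) _ (π.residueFieldMap x').hom.toAlgebra :=
  dirDim_le_dirDimOver_of_hsFun_eq CossartJannsenSaito2020_thm_3_10_4_holds hX hD hπ hN hx hnear

/-- **`e_{x'}(X') ≤ e_x(X)` at a near point with `κ(x) ⥲ κ(x')`, unconditionally** (every characteristic, `κ(x)` imperfect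
allowed). [cite: CossartJannsenSaito2020, Thm. 3.10 (4), Def. 6.34 (i)] -/
theorem dirDim_le_of_hsFun_eq_of_isIso_residueFieldMap_unconditional (hX : Scheme.IsExcellent X)
    (hD : IdealSheafData.IsPermissible D) (hπ : IsBlowup π D) {N : ℕ} (hN : topologicalKrullDim X ≤ (N : WithBot ℕ∞))
    {x' : X'} (hx : π.base x' ∈ (D.support : Set X)) (hnear : Scheme.hsFun X' N x' = Scheme.hsFun X N (π.base x'))
    [IsIso (π.residueFieldMap x')] : Scheme.dirDim X' x' ≤ Scheme.dirDim X (π.base x') :=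
  dirDim_le_of_hsFun_eq_of_isIso_residueFieldMap CossartJannsenSaito2020_thm_3_10_4_holds hX hD hπ hN hx hnear

/-- **`e_{x′}(X′) ≤ e_x(X)` at a near point with BIJECTIVE residue map, unconditionally** (binder-free form of
`…WLadderNearPointDirDim.dirDim_le_dirDim_of_hsFun_eq_of_bijective`). [cite: CossartJannsenSaito2020, Thm. 3.10 (4)] -/
theorem dirDim_le_dirDim_of_hsFun_eq_of_bijective_unconditional (hX : Scheme.IsExcellent X)
    (hD : IdealSheafData.IsPermissible D) (hπ : IsBlowup π D) {N : ℕ} (hN : topologicalKrullDim X ≤ (N : WithBot ℕ∞))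
    {x' : X'} (hx : π.base x' ∈ (D.support : Set X)) (hnear : Scheme.hsFun X' N x' = Scheme.hsFun X N (π.base x'))
    (hbij : Function.Bijective (π.residueFieldMap x').hom) : Scheme.dirDim X' x' ≤ Scheme.dirDim X (π.base x') :=
  SigmaMaxModificationsCorridor3.Moving.dirDim_le_dirDim_of_hsFun_eq_of_bijective CossartJannsenSaito2020_thm_3_10_4_holds
    hX hD hπ hN hx hnear hbij

/-- **The W-ladder bundle of SIX printed facts from the other FIVE**: the conjunct `CossartJannsenSaito2020_thm_3_10_4` of
`Moving.LocalChainPrintedFacts` is supplied by the tree. [cite: CossartJannsenSaito2020, Thm. 3.10 (4)] -/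
theorem localChainPrintedFacts_of_five (h₁ : Corollary637_char_loc.{u}) (h₂ : KeyTheorem640_char_localized_isolated.{u})
    (h₃ : CossartJannsenSaito2020_thm_3_14.{u}) (h₅ : Kollar2007_thm_1_101_localChain.{u}) (h₆ : Thm314_point_locus.{u}) :
    SigmaMaxModificationsCorridor3.Moving.LocalChainPrintedFacts.{u} :=
  ⟨h₁, h₂, h₃, CossartJannsenSaito2020_thm_3_10_4_holds, h₅, h₆⟩

end CampaignW42

end Summit.ResolutionOfSingularities.ResolutionOfSingularities.Theorems

end
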